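import Mathlib.Topology.EMetricSpace.BoundedVariation
import Literature.NumberTheory.LFunctions.AlternativeHypothesis
import HarnessLib

/-!
# The Alternative Hypothesis, II: the shape of Montgomery's form factor under AH-Pairs
# (Baluyot–Goldston–Suriajaya–Turnage-Butterbaugh 2025, Theorem 3, Corollary 4, Theorem 4,
# Lemma 5 (Heath-Brown), Corollary 5, Lemma 6)

Topic `Literature/NumberTheory/LFunctions` (namespace `Literature.NumberTheory.LFunctions`, paper
objects in `AH`). STATEMENT LAYER, cell `rh-crit/ah` (C5, typer t5), second half of the BGSTB 2025
section list; continues `AlternativeHypothesis.lean` (AH-Pairs, `P_{k/2}`, Theorems 1–2,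
Corollaries 1–3, MT-Pairs). LABEL: **NOT RH-BEARING** — every statement is a CONDITIONAL with its
hypotheses (`RiemannHypothesis`, AH-Pairs with its data `(M, R)`, AH-Density) explicit; all are
CLAIMS of an unrefereed preprint (D-0012), named `Prop`s taken as hypotheses; nothing here bears on
the truth of RH or of AH.

## What the source prints (held TeX text `paper:arxiv-2508.10857`, chunks p0007–p0016)

* §2 (p0007:L101–p0008:L33): the delta functions `δ_a`, `δ_a^=`, `δ_a^+`, `δ_a^-` ("for any `η > 0`,
  `∫_{a−η}^{a} δ_a^= = ∫_a^{a+η} δ_a^= = 1/2`; `∫_{a−η}^{a} δ_a^+ = 0`, `∫_a^{a+η} δ_a^+ = 1`;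
  `∫_{a−η}^{a} δ_a^- = 1`, `∫_a^{a+η} δ_a^- = 0`"), display (calF)
  `𝓕(α) := s(α) + δ_0^=(α) + δ_1^+(α) + δ_{−1}^−(α) + ∑_{n≥1} (δ_{2n}(α) + δ_{−2n}(α))
   + 2(P_0 − 1) ∑_{n≥2} (δ_{2n−1}(α) + δ_{1−2n}(α))`, (s(alpha)) `s(α) = |α|` for `|α| ≤ 1`,
  `s(α + 2) = s(α)`; (F-delta) "If we only make use of the ordinary delta function then (calF) is
  equivalent to `𝓕(α) = min(α, 2 − α) + δ_0(α) + 2(P_0 − 1) δ_1(α)` for `0 ≤ α ≤ 2`, together with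
  `𝓕(−α) = 𝓕(α)`, `𝓕(α + 2) = 𝓕(α)`." **Theorem 3** (p0008:L35–L40), Remark 8, **Corollary 4**
  (p0008:L46–L65), **Theorem 4** (p0008:L69–L71) — quoted in the docstrings below.
* §5 (p0012): (G_λ) `G_λ(α) := (1/λ²) ∫_{−λ}^{λ} (λ − |β|) F(α + β) dβ = (1/λ²) ∫ k_λ(β) F(α + β) dβ`,
  (k_λ) `k_λ(β) = max(λ − |β|, 0)`, (K-Fejer) `K_λ(y) = (sin(λy/2)/(λy/2))²`, (G_λ2), (E_G)
  `E_G(λ, α) := 1/(λ²M) + (|α| + 1) M² R(T) + 1/log T` "where `M`, `T`, and `R(T)` are from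
  AH-Pairs"; **Lemma 5 (Heath-Brown)** (p0012:L31–L47), **Corollary 5** (p0012:L51–L54).
* §6 (p0014:L1–L33): **Lemma 6** (i)–(v).

## Rendering / design choices

* `F(α) = montgomeryFormFactor α T` (tree); `G_λ(α) = AH.heathBrownG λ α T` (interval integral);
  `∫_a^b 𝓕 g = AH.calFIntegral P₀ a b g` with `P₀ := P_0(T) = AH.binDensity 0 T M δ` — the source's
  `𝓕` depends on `T` through `P_0(T)`, so "`∫ F g = ∫ 𝓕 g + o(1)`" is typed as the difference
  tending to `0`; bin half-width `0 < δ ≤ 1/2` and "`M` large" (`∀ᶠ M`) as in part I.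
* ERRATUM NOTE (arXiv v1): (calF) prints `δ_1^+ + δ_{−1}^−` with coefficient `1`, but (F-delta),
  Lemma 6 (iii)/(iv), display (K=1iii) "`∫_1^{1+λ} F(w) dw = 2(P_0 − 1) + …`" and the proof of
  Corollary 4 (term `2(P_0 − 1)/(2n − 1)²` at `n = 1`) give these one-sided masses the coefficient
  `2(P_0 − 1)`; `AH.calFIntegral` follows (F-delta) and the proofs (flagged to the cell referee).
* Error terms involving the AH-Pairs rate `R(T)` and level `M`: `AHPairsAt M` is
  `∃ R, AH.IsPairsRate M R` (`ahPairsAt_iff`, `Iff.rfl`), and Lemma 5 (iii)–(iv), Corollary 5,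
  Lemma 6 quantify over `(M, R)` with `AH.IsPairsRate M R`, with `AH.errG M (R T) T λ α = E_G(λ, α)`.
  All `O(·)`s of one display share ONE constant `C` valid for all large `T`, uniformly in the
  displayed parameters (`λ`, `α`, `L`, `K`), the dependence on which is explicit in the source.
* "Riemann integrable on `[a, b]`" (Theorem 3) = Lebesgue's criterion: bounded on `[a, b]` and
  continuous within `[a, b]` at a.e. point. "Lipschitz at a point", right- and left-Lipschitz: the
  source's definitions (`IsLipschitzAt` in part I, `IsRightLipschitzAt`, `IsLeftLipschitzAt` here).
* Theorem 4's `r̂` is Mathlib's `𝓕` of `r` (complex-valued), "bounded variation" = Mathlib's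
  `BoundedVariationOn · univ`; the identity is stated in `ℂ`.
* Corollary 4 (i)'s "Montgomery's conjecture that `F(α) ∼ 1` for `1 ≤ α ≤ U` for arbitrarily large
  `U`" is the UNIFORM-on-`[1, U]` version, spelled out inline (the tree's
  `MontgomeryStrongPairCorrelation` is pointwise); `𝒞` "if this limit exists" — the proofs show the
  limit exists, typed as `Tendsto`. PROVED: (iii), (iv) are (ii) at `p_0 = 1`, `3/2 − 2/π²`
  (`bgstb2025_corollary4_special_of_general`, two `ring` identities).
* Lemma 6 (ii) and (v) are not typed ((ii) needs the auxiliary `2L`/`‖α‖` bookkeeping; (v) is an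
  internal step); Lemmas 2–4 of §2 (proof-internal) are not typed.

## References

* [BaluyotGoldstonSuriajayaTurnageButterbaugh2025] arXiv:2508.10857, §2 (calF)–(Fproperties),
  Theorem 3, Remark 8, Corollary 4, Theorem 4; §5 (G_λ)–(E_G), Lemma 5, Corollary 5; §6 Lemma 6;
  §7 (proofs of Theorem 3 and Corollary 4). UNREFEREED (claims under review).
* [Montgomery1973] (`montgomeryFormFactor`); D. R. Heath-Brown, AIM lecture 1996 (the origin of
  `G_λ`, as reported by BGSTB §5); D. A. Goldston, J. Number Theory 27 (1987) (the constant `𝒞`, as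
  reported by BGSTB Corollary 4).
-/

noncomputable section

open Filter Set MeasureTheory Asymptotics
open scoped Real Topology FourierTransform

namespace Literature.NumberTheory.LFunctions

/-! ## §1. AH-Pairs with its rate made explicit; the error term `E_G` -/

namespace AH

/-- **AH-Pairs at level `M` with rate `R`** — the body of `AHPairsAt M` with the existentially
quantified "positive decreasing `R(T) → 0`" exposed, so that error terms of BGSTB 2025 that involve
`R(T)` (their `E_G(λ, α)`) can be stated: `AHPairsAt M ↔ ∃ R, IsPairsRate M R` (`ahPairsAt_iff`,
by `Iff.rfl`). [cite: BaluyotGoldstonSuriajayaTurnageButterbaugh2025, §1 (AH-Pairs)] -/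
def IsPairsRate (M : ℝ) (R : ℝ → ℝ) : Prop :=
  (∀ T, 0 < R T) ∧ Antitone R ∧ Tendsto R atTop (𝓝 0) ∧
    ∃ C : ℝ, ∀ᶠ T : ℝ in atTop, ∀ p ∈ AH.pairs T M, ∃ k : ℤ,
      |AH.pairSpacing T p - (k : ℝ) / 2| ≤ C * (|(k : ℝ)| + 1) * R T

/-- `AHPairsAt M ↔ ∃ R, IsPairsRate M R` (definitional). [cite: BaluyotGoldstonSuriajayaTurnageButterbaugh2025, §1 (AH-Pairs)] -/
theorem _root_.Literature.NumberTheory.LFunctions.ahPairsAt_iff (M : ℝ) :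
    AHPairsAt M ↔ ∃ R : ℝ → ℝ, IsPairsRate M R :=
  Iff.rfl

/-- **BGSTB's condensed error term `E_G(λ, α) := 1/(λ²M) + (|α| + 1) M² R(T) + 1/log T`**
(BGSTB 2025, §5, display (E_G): "where `M`, `T`, and `R(T)` are from AH-Pairs"), as a function of
`M`, the value `R(T)`, `T`, `λ` and `α`. [cite: BaluyotGoldstonSuriajayaTurnageButterbaugh2025, §5 (E_G)] -/
def errG (M RT T lam α : ℝ) : ℝ :=
  1 / (lam ^ 2 * M) + (|α| + 1) * M ^ 2 * RT + 1 / Real.log T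

/-! ## §2. Heath-Brown's smoothed form factor `G_λ(α)` (BGSTB 2025, §5) -/

/-- **`G_λ(α) := (1/λ²) ∫_{−λ}^{λ} (λ − |β|) F(α + β) dβ`** (BGSTB 2025, §5, display (G_λ), "following
Heath-Brown 1996"): the average of Montgomery's form factor `F(·, T) = montgomeryFormFactor · T`
against the triangle `k_λ(β) = max(λ − |β|, 0)` (total mass `λ²`). By the Fejér-kernel identity
(BGSTB (K-Fejer), (G_λ2)) it equals `((T/2π) log T)⁻¹ ∑_{0<γ,γ'≤T} T^{iα(γ−γ')} K_λ((γ−γ') log T) w(γ−γ')`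
with `K_λ(y) = (sin(λy/2)/(λy/2))²`. [cite: BaluyotGoldstonSuriajayaTurnageButterbaugh2025, §5 (G_λ)] -/
def heathBrownG (lam α T : ℝ) : ℝ :=
  1 / lam ^ 2 * ∫ β in (-lam)..lam, (lam - |β|) * montgomeryFormFactor (α + β) T

/-- `G_λ` is even in `α` (BGSTB 2025, Lemma 5, first sentence: "`G_λ(α)` is even"; from
`F(−α) = F(α)`, `montgomeryFormFactor_neg`, and `β ↦ −β`). [cite: BaluyotGoldstonSuriajayaTurnageButterbaugh2025, Lemma 5] -/
theorem heathBrownG_neg (lam α T : ℝ) : heathBrownG lam (-α) T = heathBrownG lam α T := by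
  unfold heathBrownG
  congr 1
  have h := intervalIntegral.integral_comp_neg (a := -lam) (b := lam)
    (fun b : ℝ ↦ (lam - |b|) * montgomeryFormFactor (α + b) T)
  simp only [neg_neg] at h
  rw [← h]
  refine intervalIntegral.integral_congr fun β _ ↦ ?_
  simp only [abs_neg]
  rw [show α + -β = -(-α + β) by ring, montgomeryFormFactor_neg]

/-- **`∫_a^b 𝓕(α) g(α) dα`** for BGSTB's limiting form factor `𝓕` (BGSTB 2025, §2, displays
(calF), (F-delta), (Fproperties)): `𝓕(α) = s(α) + δ_0(α) + 2(P_0 − 1) δ_1(α)` on `0 ≤ α ≤ 2`,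
extended evenly and 2-periodically (`s = triangleWave`; unit point masses at the even integers,
masses `2(P_0 − 1)` at the odd integers), with the one-sided refinements of (calF) at `0, ±1`:
`δ_0^=` (half of the mass on each side of `0`), `δ_1^+` (mass just to the right of `1`), `δ_{−1}^−`
(mass just to the left of `−1`). So, for `a ≤ b` with `a, b ∉ ℤ ∖ {−1, 0, 1}`:
`∫_a^b 𝓕 g = ∫_a^b s g + g(0)(½[a<0≤b] + ½[a≤0<b]) + 2(P_0−1)(g(1)[a≤1<b] + g(−1)[a<−1≤b])
 + ∑_{m even ≠ 0, a<m<b} g(m) + 2(P_0−1) ∑_{m odd, |m|≥3, a<m<b} g(m)`.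
ERRATUM NOTE: display (calF) of arXiv v1 prints the terms `δ_1^+ + δ_{−1}^−` with coefficient `1`;
the equivalent form (F-delta) ("`2(P_0 − 1) δ_1(α)`"), Lemma 6 (iii)–(iv) and display (K=1iii)
("`∫_1^{1+λ} F(w) dw = 2(P_0 − 1) + O(λ) + …`") and the proof of Corollary 4 (the term
`2(P_0−1)/(2n−1)²` from `n = 1`) all give these masses the coefficient `2(P_0 − 1)`, which is what is
typed here. The parameter `P₀` stands for `P_0(T)` (the density of the diagonal bin at height `T`).
[cite: BaluyotGoldstonSuriajayaTurnageButterbaugh2025, §2 (calF)–(F-delta)] -/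
def calFIntegral (P₀ a b : ℝ) (g : ℝ → ℝ) : ℝ :=
  (∫ α in a..b, triangleWave α * g α) +
    g 0 * ((if a < 0 ∧ 0 ≤ b then 1 / 2 else 0) + (if a ≤ 0 ∧ 0 < b then 1 / 2 else 0)) +
    2 * (P₀ - 1) *
      (g 1 * (if a ≤ 1 ∧ 1 < b then 1 else 0) + g (-1) * (if a < -1 ∧ -1 ≤ b then 1 else 0)) +
    (∑ m ∈ (Finset.Ioo ⌊a⌋ ⌈b⌉).filter (fun m ↦ Even m ∧ m ≠ 0), g m) +
    2 * (P₀ - 1) * ∑ m ∈ (Finset.Ioo ⌊a⌋ ⌈b⌉).filter (fun m ↦ Odd m ∧ 3 ≤ |m|), g m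

end AH

/-- Right-Lipschitz continuity at `a` ("in neighborhoods `a ≤ x < a + δ`", BGSTB 2025, §2, before
(MT-Pairs)). [cite: BaluyotGoldstonSuriajayaTurnageButterbaugh2025, §2 (before MT-Pairs)] -/
def IsRightLipschitzAt (f : ℝ → ℝ) (a : ℝ) : Prop :=
  ∃ C δ : ℝ, 0 < δ ∧ ∀ x : ℝ, a ≤ x → x < a + δ → |f x - f a| ≤ C * |x - a|

/-- Left-Lipschitz continuity at `a` ("in neighborhoods `a − δ < x ≤ a`", BGSTB 2025, §2, before
(MT-Pairs)). [cite: BaluyotGoldstonSuriajayaTurnageButterbaugh2025, §2 (before MT-Pairs)] -/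
def IsLeftLipschitzAt (f : ℝ → ℝ) (a : ℝ) : Prop :=
  ∃ C δ : ℝ, 0 < δ ∧ ∀ x : ℝ, a - δ < x → x ≤ a → |f x - f a| ≤ C * |x - a|

/-! ## §3. BGSTB 2025, Theorem 3, Corollary 4, Theorem 4 (claims; named `Prop`s) -/

/-- **BGSTB 2025, Theorem 3** (arXiv preprint, UNDER REVIEW; the shape of `F(α)` beyond `|α| ≤ 1`
under RH and AH-Pairs): "Let `g` be a Riemann integrable function on a closed interval `[a, b]`,
where `a, b ∉ ℤ ∖ {−1, 0, 1}`. Suppose in addition that `g` is Lipschitz continuous at `ℤ ∖ {−1, 1}`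
and also right-Lipschitz continuous at `1` and left-Lipschitz continuous at `−1`. Assuming the
Riemann Hypothesis and AH-Pairs, we have as `T → ∞` that
`∫_a^b F(α) g(α) dα = ∫_a^b 𝓕(α) g(α) dα + o(1)`, where `𝓕` is given in (calF)."
Rendering: `F = montgomeryFormFactor`; `∫_a^b 𝓕 g = AH.calFIntegral (P_0(T)) a b g` with
`P_0(T) = AH.binDensity 0 T M δ` for any fixed bin half-width `0 < δ ≤ 1/2` and all large `M`
(`∀ᶠ M`; the bin is independent of `M ≥ δ/2`); "Riemann integrable on `[a, b]`" is rendered by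
Lebesgue's criterion (bounded on `[a, b]` and continuous within `[a, b]` at almost every point);
`a ≤ b`. See `AH.calFIntegral` for the coefficient of the masses at `±1` ((calF) vs (F-delta)).
CLAIM of an unrefereed source, not proved here. [claim: BaluyotGoldstonSuriajayaTurnageButterbaugh2025, status: under-review] -/
def bgstb2025_theorem3 : Prop :=
  RiemannHypothesis → AHPairs →
    ∀ (a b : ℝ) (g : ℝ → ℝ), a ≤ b →
      (∀ m : ℤ, m ≠ -1 → m ≠ 0 → m ≠ 1 → (a ≠ m ∧ b ≠ m)) →
      (∃ B : ℝ, ∀ x ∈ Icc a b, |g x| ≤ B) →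
      (∀ᵐ x ∂(volume.restrict (Icc a b)), ContinuousWithinAt g (Icc a b) x) →
      (∀ m : ℤ, m ≠ -1 → m ≠ 1 → IsLipschitzAt g m) →
      IsRightLipschitzAt g 1 → IsLeftLipschitzAt g (-1) →
        ∀ δ : ℝ, 0 < δ → δ ≤ 1 / 2 → ∀ᶠ M : ℝ in atTop,
          Tendsto (fun T : ℝ ↦ (∫ α in a..b, montgomeryFormFactor α T * g α) -
            AH.calFIntegral (AH.binDensity 0 T M δ) a b g) atTop (𝓝 0)

/-- **BGSTB 2025, Corollary 4** (arXiv preprint, UNDER REVIEW; the constant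
`𝒞 := lim_{T→∞} ∫_1^∞ F(α)/α² dα` of Goldston 1987 "if this limit exists"). As printed:
"(i) Assuming the Riemann Hypothesis and Montgomery's [prediction, Montgomery 1973 (11)] that `F(α) ∼ 1`
for `1 ≤ α ≤ U` for arbitrarily large `U`. Then `𝒞 = 1`. (ii) Suppose that the limiting density `p_0` exists, then
assuming the Riemann Hypothesis and AH-Pairs we obtain `𝒞 = 1 + (3/2 (p_0 − 1) + 1/4) π²/6 + log(2/π)`.
(iii) In the particular case when `p_0 = 1`, the Riemann Hypothesis and AH-Pairs imply
`𝒞 = 1 + π²/24 + log(2/π) = 0.95965…`. (iv) In the other extreme case `p_0 = 3/2 − 2/π²`, the Riemann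
Hypothesis and AH-Pairs then imply `𝒞 = 1/2 + π²/6 + log(2/π) = 1.69335…`." In each case the proof
shows that the limit exists (`∫_1^∞ F/α² = 𝒞 + o(1)`), which is what is typed (`Tendsto`).
Montgomery's hypothesis in (i) is the version UNIFORM on `[1, U]` (the tree's
`MontgomeryStrongPairCorrelation` records only the pointwise one), spelled out inline; "`p_0`
exists" is `AH.HasLimitingDensity 0 δ p₀` for a bin half-width `0 < δ ≤ 1/2`. CLAIM of an
unrefereed source, not proved here. [claim: BaluyotGoldstonSuriajayaTurnageButterbaugh2025, status: under-review] -/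
def bgstb2025_corollary4 : Prop :=
  (RiemannHypothesis →
    (∀ U : ℝ, 1 ≤ U → ∀ ε : ℝ, 0 < ε → ∀ᶠ T : ℝ in atTop, ∀ α ∈ Icc 1 U,
        |montgomeryFormFactor α T - 1| ≤ ε) →
      Tendsto (fun T : ℝ ↦ ∫ α in Ioi (1 : ℝ), montgomeryFormFactor α T / α ^ 2) atTop (𝓝 1)) ∧
  (RiemannHypothesis → AHPairs → ∀ δ : ℝ, 0 < δ → δ ≤ 1 / 2 → ∀ p₀ : ℝ,
    AH.HasLimitingDensity 0 δ p₀ →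
      Tendsto (fun T : ℝ ↦ ∫ α in Ioi (1 : ℝ), montgomeryFormFactor α T / α ^ 2) atTop
        (𝓝 (1 + (3 / 2 * (p₀ - 1) + 1 / 4) * (π ^ 2 / 6) + Real.log (2 / π)))) ∧
  (RiemannHypothesis → AHPairs → ∀ δ : ℝ, 0 < δ → δ ≤ 1 / 2 → AH.HasLimitingDensity 0 δ 1 →
      Tendsto (fun T : ℝ ↦ ∫ α in Ioi (1 : ℝ), montgomeryFormFactor α T / α ^ 2) atTop
        (𝓝 (1 + π ^ 2 / 24 + Real.log (2 / π)))) ∧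
  (RiemannHypothesis → AHPairs → ∀ δ : ℝ, 0 < δ → δ ≤ 1 / 2 →
    AH.HasLimitingDensity 0 δ (3 / 2 - 2 / π ^ 2) →
      Tendsto (fun T : ℝ ↦ ∫ α in Ioi (1 : ℝ), montgomeryFormFactor α T / α ^ 2) atTop
        (𝓝 (1 / 2 + π ^ 2 / 6 + Real.log (2 / π))))

/-- The arithmetic of Corollary 4 (iii): at `p_0 = 1` the constant of (ii) is `1 + π²/24 + log(2/π)`.
[claim: BaluyotGoldstonSuriajayaTurnageButterbaugh2025, status: under-review] -/
theorem bgstb2025_corollary4_const_one :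
    1 + (3 / 2 * ((1 : ℝ) - 1) + 1 / 4) * (π ^ 2 / 6) + Real.log (2 / π) =
      1 + π ^ 2 / 24 + Real.log (2 / π) := by
  ring

/-- The arithmetic of Corollary 4 (iv): at `p_0 = 3/2 − 2/π²` the constant of (ii) is
`1/2 + π²/6 + log(2/π)`. [claim: BaluyotGoldstonSuriajayaTurnageButterbaugh2025, status: under-review] -/
theorem bgstb2025_corollary4_const_extreme :
    1 + (3 / 2 * ((3 / 2 - 2 / π ^ 2 : ℝ) - 1) + 1 / 4) * (π ^ 2 / 6) + Real.log (2 / π) =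
      1 / 2 + π ^ 2 / 6 + Real.log (2 / π) := by
  have hπ : (π : ℝ) ≠ 0 := Real.pi_ne_zero
  field_simp
  ring

/-- Corollary 4 (iii) and (iv) follow from (ii) (specialise `p_0` and use the two identities
above). [claim: BaluyotGoldstonSuriajayaTurnageButterbaugh2025, status: under-review] -/
theorem bgstb2025_corollary4_special_of_general
    (h : RiemannHypothesis → AHPairs → ∀ δ : ℝ, 0 < δ → δ ≤ 1 / 2 → ∀ p₀ : ℝ,
      AH.HasLimitingDensity 0 δ p₀ →
        Tendsto (fun T : ℝ ↦ ∫ α in Ioi (1 : ℝ), montgomeryFormFactor α T / α ^ 2) atTop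
          (𝓝 (1 + (3 / 2 * (p₀ - 1) + 1 / 4) * (π ^ 2 / 6) + Real.log (2 / π)))) :
    (RiemannHypothesis → AHPairs → ∀ δ : ℝ, 0 < δ → δ ≤ 1 / 2 → AH.HasLimitingDensity 0 δ 1 →
        Tendsto (fun T : ℝ ↦ ∫ α in Ioi (1 : ℝ), montgomeryFormFactor α T / α ^ 2) atTop
          (𝓝 (1 + π ^ 2 / 24 + Real.log (2 / π)))) ∧
    (RiemannHypothesis → AHPairs → ∀ δ : ℝ, 0 < δ → δ ≤ 1 / 2 →
      AH.HasLimitingDensity 0 δ (3 / 2 - 2 / π ^ 2) →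
        Tendsto (fun T : ℝ ↦ ∫ α in Ioi (1 : ℝ), montgomeryFormFactor α T / α ^ 2) atTop
          (𝓝 (1 / 2 + π ^ 2 / 6 + Real.log (2 / π)))) := by
  constructor
  · intro hRH hAH δ hδ hδ' h1
    rw [← bgstb2025_corollary4_const_one]
    exact h hRH hAH δ hδ hδ' 1 h1
  · intro hRH hAH δ hδ hδ' h1
    rw [← bgstb2025_corollary4_const_extreme]
    exact h hRH hAH δ hδ hδ' _ h1

/-- **BGSTB 2025, Theorem 4** (arXiv preprint, UNDER REVIEW; "an application of AH-Density":
MT-Pairs' main term "making use of AH-Pairs and AH-Density but not RH or explicit formulas"):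
"Suppose both `r(t)` and `r̂(α)` are even `L¹(ℝ)` functions with bounded variation, and suppose
further that `r(α)` has support in `|α| ≤ 1`. Then assuming AH-Density, we have
`∑_{k∈ℤ} r̂(k/2) p_{k/2} = r(0) + 2∫₀¹ α r(α) dα`." Rendering: `r : ℝ → ℝ`, `r̂ = 𝓕 r` (Mathlib,
complex-valued), the `p_{k/2}` are the limiting densities (`AH.HasLimitingDensity k δ (p k)` for a
bin half-width `0 < δ ≤ 1/2`; unique, and under `AHDensity δ` equal to `AH.densityTable p_0 k`);
the identity is stated in `ℂ`. CLAIM of an unrefereed source, not proved here.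
[claim: BaluyotGoldstonSuriajayaTurnageButterbaugh2025, status: under-review] -/
def bgstb2025_theorem4 : Prop :=
  ∀ δ : ℝ, 0 < δ → δ ≤ 1 / 2 → AHDensity δ → ∀ p : ℤ → ℝ,
    (∀ k : ℤ, AH.HasLimitingDensity k δ (p k)) →
    ∀ r : ℝ → ℝ, Integrable r → (∀ t, r (-t) = r t) → BoundedVariationOn r univ →
      (∀ t, 1 < |t| → r t = 0) →
      Integrable (𝓕 (fun t : ℝ ↦ (r t : ℂ))) →
      BoundedVariationOn (𝓕 (fun t : ℝ ↦ (r t : ℂ))) univ →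
        ∑' k : ℤ, 𝓕 (fun t : ℝ ↦ (r t : ℂ)) ((k : ℝ) / 2) * (p k : ℂ) =
          ((r 0 + 2 * ∫ a in (0 : ℝ)..1, a * r a : ℝ) : ℂ)

/-! ## §4. BGSTB 2025, Lemma 5 (Heath-Brown), Corollary 5, Lemma 6 (claims; named `Prop`s) -/

/-- **BGSTB 2025, Lemma 5 (Heath-Brown), (i)–(ii)** (arXiv preprint, UNDER REVIEW; the RH half):
"For `α ∈ ℝ` and `0 < λ < 1` the function `G_λ(α)` is even and non-negative. Let `λ` satisfy
`0 < λ ≤ 1/2`. Assuming the Riemann Hypothesis, we have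
(i) `G_λ(α) = (λ − |α|)/λ² + O(λ) + O(1/(λ √log T)) + O(1/(λ² log T))` for `|α| < λ`,
(ii) `G_λ(α) = |α| + O(1/√log T) + O(1/(λ² log T))` for `λ ≤ |α| ≤ 1 − λ`."
Rendered with ONE absolute `O`-constant `C`, for all large `T`, uniformly in `0 < λ ≤ 1/2` and `α`
(the displayed dependence on `λ`, `α` being explicit); non-negativity (from `F ≥ 0`, part of (MT))
is included, evenness is the proved `AH.heathBrownG_neg`. CLAIM of an unrefereed source (its
input is (MT) with the Goldston–Montgomery error term), not proved here.
[claim: BaluyotGoldstonSuriajayaTurnageButterbaugh2025, status: under-review] -/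
def bgstb2025_lemma5_rh : Prop :=
  RiemannHypothesis →
    (∀ lam α T : ℝ, 0 < lam → lam < 1 → 1 < T → 0 ≤ AH.heathBrownG lam α T) ∧
    ∃ C : ℝ, ∀ᶠ T : ℝ in atTop, ∀ lam : ℝ, 0 < lam → lam ≤ 1 / 2 → ∀ α : ℝ,
      (|α| < lam →
        |AH.heathBrownG lam α T - (lam - |α|) / lam ^ 2| ≤
          C * (lam + 1 / (lam * Real.sqrt (Real.log T)) + 1 / (lam ^ 2 * Real.log T))) ∧
      (lam ≤ |α| → |α| ≤ 1 - lam →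
        abs (AH.heathBrownG lam α T - |α|) ≤
          C * (1 / Real.sqrt (Real.log T) + 1 / (lam ^ 2 * Real.log T)))

/-- **BGSTB 2025, Lemma 5 (Heath-Brown), (iii)–(iv)** (arXiv preprint, UNDER REVIEW; the AH-Pairs
half): "Assuming AH-Pairs, we have
(iii) `G_λ(α) = ∑_{k∈ℤ} e^{iπkα} (sin(λπk/2)/(λπk/2))² P_{k/2} + O(E_G(λ, α))`, and for `L ∈ ℤ`,
(iv) `G_λ(α + 2L) = G_λ(α) + O(E_G(λ, |α| + 2L))`", `E_G(λ, α) = 1/(λ²M) + (|α| + 1)M²R(T) + 1/log T`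
"where `M`, `T`, and `R(T)` are from AH-Pairs". Rendered: for every level `M > 0` and rate `R` with
`AH.IsPairsRate M R`, and every bin half-width `0 < δ ≤ 1/2` (the `P_{k/2} = AH.binDensity k T M δ`;
under AH-Pairs the bins do not depend on `δ` for large `T`), there is `C` with, for all large `T`,
all `0 < λ ≤ 1/2` and all `α`, the two displayed bounds (`(sin x/x)² = Real.sinc²`; the `k`-sum is
a `tsum`, all but finitely many bins being empty). CLAIM of an unrefereed source, not proved here.
[claim: BaluyotGoldstonSuriajayaTurnageButterbaugh2025, status: under-review] -/
def bgstb2025_lemma5_ah : Prop :=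
  ∀ M : ℝ, 0 < M → ∀ R : ℝ → ℝ, AH.IsPairsRate M R → ∀ δ : ℝ, 0 < δ → δ ≤ 1 / 2 →
    ∃ C : ℝ, ∀ᶠ T : ℝ in atTop, ∀ lam : ℝ, 0 < lam → lam ≤ 1 / 2 → ∀ α : ℝ,
      ‖(AH.heathBrownG lam α T : ℂ) -
          ∑' k : ℤ, Complex.exp (π * k * α * Complex.I) *
            ((Real.sinc (lam * π * k / 2) ^ 2 * AH.binDensity k T M δ : ℝ) : ℂ)‖ ≤
        C * AH.errG M (R T) T lam α ∧
      ∀ L : ℤ, |AH.heathBrownG lam (α + 2 * L) T - AH.heathBrownG lam α T| ≤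
        C * AH.errG M (R T) T lam (|α| + 2 * L)

/-- **BGSTB 2025, Corollary 5** (arXiv preprint, UNDER REVIEW): "Assuming the Riemann Hypothesis and
AH-Pairs, we have, for `0 < λ ≤ 1/4`,
`∫_{1−λ}^{1+λ} G_λ(α) dα = 2(P_0 − 1) + O(λ) + O(E_G(λ, 1)) + O(1/(λ² √log T))`."
Rendered with the AH-Pairs data `(M, R)` explicit as in `bgstb2025_lemma5_ah`, `P_0 = AH.binDensity 0 T M δ`.
CLAIM of an unrefereed source, not proved here. [claim: BaluyotGoldstonSuriajayaTurnageButterbaugh2025, status: under-review] -/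
def bgstb2025_corollary5 : Prop :=
  RiemannHypothesis → ∀ M : ℝ, 0 < M → ∀ R : ℝ → ℝ, AH.IsPairsRate M R →
    ∀ δ : ℝ, 0 < δ → δ ≤ 1 / 2 →
      ∃ C : ℝ, ∀ᶠ T : ℝ in atTop, ∀ lam : ℝ, 0 < lam → lam ≤ 1 / 4 →
        |(∫ α in (1 - lam)..(1 + lam), AH.heathBrownG lam α T) - 2 * (AH.binDensity 0 T M δ - 1)| ≤
          C * (lam + AH.errG M (R T) T lam 1 + 1 / (lam ^ 2 * Real.sqrt (Real.log T)))

/-- **BGSTB 2025, Lemma 6** (arXiv preprint, UNDER REVIEW; averages of `F(α)` over short intervals,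
from Lemma 5 by a differencing argument). "Assume the Riemann Hypothesis and AH-Pairs. Then for
`L ∈ ℤ` and `0 < λ ≤ 1/4` we have
(i) `∫_{2L−λ}^{2L+λ} F(β) dβ = 1 + O(λ²) + O(λ E_G(λ, L)) + O(1/(λ √log T))`.
For any fixed `α ∈ ℝ ∖ ℤ`, choose `λ` so that `0 < λ ≤ ½ ‖α‖`. Then …
(ii) `(1/2λ) ∫_{α−λ}^{α+λ} F(β) dβ = s(α) + O(λ) + O(1/(λ⁵ √log T)) + O((1/λ) E_G(λ, L))`
[`2L` the even integer nearest `α` as in the proof]. Let `K = 2L + 1` be an odd integer. Then for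
`0 < λ ≤ 1/4` we have
(iii) `∫_{K−λ}^{K+λ} F(β) dβ = 2(P_0 − 1) + O(λ) + O(E_G(λ², K)) + O(1/(λ⁴ √log T))`.
If `K = ±1`, then in addition to (iii) we have for `0 < λ ≤ 1/4`
(iv) `∫_{1−λ}^{1+λ} F = ∫_1^{1+λ} F + O(λ)` and `∫_{−1−λ}^{−1+λ} F = ∫_{−1−λ}^{−1} F + O(λ)`.
For `K` an odd integer, (v) `G_λ(K) = 2(P_0 − 1)/λ + O(1) + O(E_G(λ², K)/λ) + O(1/(λ⁵ √log T))`."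
Only (i), (iii), (iv) are typed (the inputs of Theorem 3's proof at the integers); `F = montgomeryFormFactor`,
AH-Pairs data `(M, R)` explicit, `P_0 = AH.binDensity 0 T M δ`, `s = triangleWave`,
one constant `C` for all large `T`, uniformly in `λ` and `L`/`K`. CLAIM of an unrefereed source,
not proved here. [claim: BaluyotGoldstonSuriajayaTurnageButterbaugh2025, status: under-review] -/
def bgstb2025_lemma6 : Prop :=
  RiemannHypothesis → ∀ M : ℝ, 0 < M → ∀ R : ℝ → ℝ, AH.IsPairsRate M R →
    ∀ δ : ℝ, 0 < δ → δ ≤ 1 / 2 →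
      ∃ C : ℝ, ∀ᶠ T : ℝ in atTop, ∀ lam : ℝ, 0 < lam → lam ≤ 1 / 4 →
        (∀ L : ℤ, |(∫ β in (2 * L - lam)..(2 * L + lam), montgomeryFormFactor β T) - 1| ≤
            C * (lam ^ 2 + lam * AH.errG M (R T) T lam L + 1 / (lam * Real.sqrt (Real.log T)))) ∧
        (∀ K : ℤ, Odd K →
          |(∫ β in (K - lam)..(K + lam), montgomeryFormFactor β T) -
              2 * (AH.binDensity 0 T M δ - 1)| ≤
            C * (lam + AH.errG M (R T) T (lam ^ 2) K +
              1 / (lam ^ 4 * Real.sqrt (Real.log T)))) ∧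
        |(∫ β in (1 - lam)..(1 + lam), montgomeryFormFactor β T) -
            ∫ β in (1 : ℝ)..(1 + lam), montgomeryFormFactor β T| ≤ C * lam ∧
        |(∫ β in (-1 - lam)..(-1 + lam), montgomeryFormFactor β T) -
            ∫ β in (-1 - lam)..(-1 : ℝ), montgomeryFormFactor β T| ≤ C * lam

/-- **BGSTB 2025, Lemma 6 (v)** (arXiv preprint, UNDER REVIEW; PDF p. 19 of v1, TeX l. 950–953),
AS PRINTED: "For `K` an odd integer,
(v) `G_λ(K) = 2(P_0 − 1)/λ + O(1) + O(E_G(λ², K)/λ) + O(1/(λ⁵ √log T))`", under the lemma's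
standing hypotheses ("Assume the Riemann Hypothesis and AH-Pairs … `0 < λ ≤ 1/4`"). Deliberately not
a conjunct of `bgstb2025_lemma6` (which records (i), (iii), (iv), the inputs of Theorem 3); recorded
here to complete the as-printed record of Lemma 6 (iii)–(v) (cell `rh-columns/lit`, human desk H4):
the printed route to (iii) runs through (v) and the tent-average display of §6 that
`AH.bgstb2025_lemma6_printed_display_fails` (`AlternativeHypothesisLemma6Proofs.lean`, erratum
E-ah-5) shows is not an identity (`F ≡ 1`, `λ = 1/4`: `1/2 ≠ 1`) — "unsupported as printed", not
refuted; a sound two-sided replacement of (iii) is `bgstb2025_lemma6_iii_lower_odd` /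
`bgstb2025_lemma6_iii_upper_odd` there. Same binders as `bgstb2025_lemma6`: `G_λ = AH.heathBrownG`,
AH-Pairs data `(M, R)` explicit, `P_0 = AH.binDensity 0 T M δ`, one constant `C` for all large `T`,
uniformly in `λ` and `K`. CLAIM of an unrefereed source, not proved here; nothing here bears on the
truth of RH. [claim: BaluyotGoldstonSuriajayaTurnageButterbaugh2025, status: under-review] -/
def bgstb2025_lemma6_v : Prop :=
  RiemannHypothesis → ∀ M : ℝ, 0 < M → ∀ R : ℝ → ℝ, AH.IsPairsRate M R →
    ∀ δ : ℝ, 0 < δ → δ ≤ 1 / 2 →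
      ∃ C : ℝ, ∀ᶠ T : ℝ in atTop, ∀ lam : ℝ, 0 < lam → lam ≤ 1 / 4 → ∀ K : ℤ, Odd K →
        |AH.heathBrownG lam K T - 2 * (AH.binDensity 0 T M δ - 1) / lam| ≤
          C * (1 + AH.errG M (R T) T (lam ^ 2) K / lam + 1 / (lam ^ 5 * Real.sqrt (Real.log T)))

end Literature.NumberTheory.LFunctions

end
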